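/-
Copyright (c) 2026. All rights reserved.
Released under Apache 2.0 license as described in the file LICENSE.
Authors: abc-iut cell, campaign-S prover seat abc-iut-S8 (wave 2).
-/
import Literature.IUT.LogVolume.LogVolumeEstimates
import Literature.IUT.LogVolume.DifferentEstimatesCorollaries
import HarnessLib

/-!
# [IUTchIV] Prop. 1.4 (iii), "Moreover" — proved

"Moreover, `d_I + a_I ≥ |I|` if `p > 2`; `d_I + a_I ≥ 2·|I|` if `p = 2`" ([IUTchIV] Prop. 1.4 (iii),
kurims p. 13; proof p. 14: "since `d_i ≥ (e_i − 1)/e_i` for all `i ∈ I` [cf. Proposition 1.3, (i)], we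
conclude that `d_i + a_i ≥ 1`").  `LogVolumeEstimates.prop14iii₃_of_different_bound` (abc-iut-S8)
proved it from the different bound; the bound itself is `sub_one_div_le_differentOrd`
(`DifferentEstimatesCorollaries.lean`, abc-iut-L5-t15: the case `k₀ = ℚ_p` of Prop. 1.3 (i)).
Nothing here bears on the disputed [IUTchIII] Cor. 3.12.
-/

noncomputable section

namespace Literature.IUT.LogVolume

variable (p : ℕ) [Fact p.Prime]
variable {I : Type} [Fintype I]
variable (k : I → Type) [∀ i, NontriviallyNormedField (k i)] [∀ i, NormedAlgebra ℚ_[p] (k i)]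
  [∀ i, IsUltrametricDist (k i)] [∀ i, ProperSpace (k i)]

/-- **[IUTchIV] Prop. 1.4 (iii), "Moreover", holds**: `d_I + a_I ≥ |I|` (`p > 2`), `≥ 2·|I|` (`p = 2`).
[cite: Mochizuki2012, IUTchIV Prop. 1.4 (iii) p. 13] -/
theorem Prop14iii₃_holds : Prop14iii₃ p k :=
  prop14iii₃_of_different_bound p k fun i ↦ sub_one_div_le_differentOrd p (k i)

end Literature.IUT.LogVolume

end
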